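import Literature.MathematicalPhysics.QuantumFieldTheory.Balaban1983to89.B6Prop26KLevelAssemblyV1
import Literature.MathematicalPhysics.QuantumFieldTheory.Balaban1983to89.B6Prop26LeftEntryKLevelV1
import Literature.MathematicalPhysics.QuantumFieldTheory.Balaban1983to89.B6Ineq2134TransposeKLevelTorus
import Literature.MathematicalPhysics.QuantumFieldTheory.Balaban1983to89.B6OpTransposeV1
import Literature.MathematicalPhysics.QuantumFieldTheory.Balaban1983to89.B6Prop26RightChainGeneric
import Literature.MathematicalPhysics.QuantumFieldTheory.Balaban1983to89.B6CubeRightLegsV1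
import Literature.MathematicalPhysics.QuantumFieldTheory.Balaban1983to89.B6Ineq2134TKFamKLevelExportV1

/-!
# `Balaban1983to89.B6Prop26MirrorAssemblyV1` — T. Bałaban, *Propagators and renormalization transformations for lattice gauge theories. II*,
# Commun. Math. Phys. **96** (1984) 223–250 [Balaban1984PropagatorsII], Prop. 2.6 (2.136) p. 247, THE RIGHT-FACTOR ENTRIES `|(G·D′J)(x)|`
# (`D′ = ∇*`: (2.136)₃) AT k LEVELS FOR THE GENUINE `G`, BY THE TRANSPOSED WALK — THE ASSEMBLY: from a displayed first leg `h_□G_□h_□·D′` per cube and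
# the displayed line 3ᵀ per cube to `HasMajorant (G·D′) (A·e^{−(1−α)σ d(y,y′)}·P(y′))`

statement-level skeleton of published theorems with citation tags; proofs where landed; nothing here is a claim about the Yang–Mills mass gap

PDF held: `paper:balaban1984-cmp96-propagators-rt-ii` (journal page = PDF page + 222); p. 247 [PDF 25] ((2.133)–(2.136), (2.141)), p. 239 [PDF 17] ((2.90)–(2.94)),
p. 234 [PDF 12] (Lemma 2.1) re-read this generation on the ×2 renders `b2b-balaban-ref1/pages/1984-cmp96-propagators-rt-II/…-p025-x2.png`, `…-p017-x2.png`.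

CITATION HEADER (lean-in-tree rule) — WHAT IS REPRODUCED.  Phase-2 file of the `lit-balaban` typed skeleton (HOME `run/shared/lean/pub/lit-balaban/`), seat
**p38 gen 31**, brick 6 of the programme «(2.136)₃ by the transposed walk»; SKELETON rows B6.Prop2.6 × B6.Eq2.91 × B6.Eq2.134 × B6.Eq2.141 (cells; decls of
record untouched).  Print (2.136) p. 247: «|(G∇*J)(x)| … ≤ O(1)L^jη e^{−δ₃d(y,y′)}|J| for x ∈ B^j(y), J ∈ A(B(y′))».  The right factor `∇*` cannot be put
through the left walk (2.91) (the last leg `∇G_□∇*` has no summable block majorant, cf. (2.138)), so print's remark after (2.141) is used: expand from the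
OTHER side.  `Δ_a`, `G`, `G_□`, `M_□`, `P_□` are symmetric ((2.18)–(2.22), `…B6OpTransposeV1`), hence `G₀Δ_a = I − R̃` with `R̃ = Σ h_{□′}G_{□′}K̃_{□□′}`
(`…B6Eq291Transpose.eq291T_sum`, fed by the transposed cube identities `hagreeT_cube`/`hinvT_cube`), `G·D′ = G₀D′ + R̃(G·D′)` and the LEFT chain
(`…B6Prop26RightChainGeneric.prop26_rightEntry_of_2133T_2134T`) glues: first legs `h_□G_□h_□D′` (DISPLAYED hypothesis, one per cube — p38's
`B6GDVaLegKLevelV1.hGDVa0_cube` for `D′ = ∇*`, brick 8), transfer legs `h_{□′}G_{□′}K̃_{□□′}` bounded for ALL pairs above one threshold by p38's `h2134T_kFamT_torus`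
(`…B6Ineq2134TransposeKLevelTorus`, the mirrored (2.134)) from: r03's `hGin_cube`, p22's `hGEin_cube`/`hGout_cube` (`…B6CubeRightLegsV1`), p38's
`hNin/hNout/hPlin/hPlout_cube`, p22's `hasMajorant_Dg_V1_TB`, the transposed commutator decomposition `hdecT_cube` and input localisation `inLoc_hB_Ml`
(`…B6OpTransposeV1`), the partition data, and the DISPLAYED line 3ᵀ `h_□(∂(1−R)∂* − P_□)ζ_□` per cube (p22's `line3_cube_transpose` shape) and line-1
coefficient sizes/supports (p38's `B6CubeCoeffSizesV1` shapes, displayed as in r03's `prop26_2136_kLevel_assembly_le`).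
* §1 small algebra: `hdecT_smul`, `inLoc_smul`, `inLoc_TB` are USED FROM the tree's `B6Ineq2134TKFamKLevelExportV1` (p22's FILE K, which copied
  this file's §1 verbatim and landed first — p391105 bounced at `dedup.landed`); the symmetry of `d_T` is the tree's `B8Ineq192MultiLevelTorus.symmT`
  (= `B6HolderPairInputsV1.geomT_dist_comm`; p381540 bounced at `dedup.landed` for a copy named `dist_comm_T`) — nothing restated;
* §2 **`prop26_2136T_kLevel_assembly_le`** — `∃ σ₀ > 0, ∀ σ ∈ (0, σ₀], ∀ α N₀ Nbig sizes, ∃ A M₁, ∀ tori above threshold … , HasMajorant (G·D′)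
  (2·Nbig·C_L·e^{−(1−α)σ d(y,y′)}·P(y′))` for ANY right factor `D′` and input weight `P ≥ 0` whose first legs are displayed;
* §3 **`prop26_2136T_kLevel_final_le`** — the overlap count (`Nbig = 3·9^{d+1}`, `card_filter_mem_QbigT_le`) and the line-1 sizes/supports
  (`B6CubeCoeffSizesV1`) DISCHARGED (line 3ᵀ and the first legs displayed; line 3ᵀ is discharged by p22's `line3_cube_transpose` in brick 7).
All theorems, proved, 0 sorry, no new `def … : Prop`; standard axioms.

HONEST SCOPE / DIVERGENCES.  (1) The prefactor sits at the INPUT block `y′` (print: at `y`; the transport `L^{j(y′)} ≤ L·e^{…}L^{j(y)}` by the level gap is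
brick 7).  (2) Hypotheses displayed, not discharged here: the `□̃` overlap count, the line-1 coefficient sizes/supports, line 3ᵀ, the first legs — exactly
as r03's direct `…_assembly_le` displays its inputs (discharged by the tree's `card_filter_mem_QbigT_le`, `B6CubeCoeffSizesV1`, p22's
`line3_cube_transpose` and p38's `hGDVa0_cube` in bricks 7–8).  (3) Rate `(1−α)σ` with `σ ≤ σ₀(d, L, b₀, b₁)`; constants depend on `d, L, b₀, b₁` and the displayed
sizes only — uniform in `k` and in the torus.  Nothing on d = 4 or the continuum; NOT summit progress.  Unit `lit-balaban-p38` (gen 31), 2026-08-23.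
-/

noncomputable section

open scoped BigOperators
open Finset

namespace Literature.MathematicalPhysics.QuantumFieldTheory.Balaban1983to89.B6Prop26MirrorAssemblyV1

open B4Reflection242 (boxDom)
open B6MultiLevelBoxOperator (N0)
open B6MultiLevelTorusOperator (TDomains)
open B6Cover236MultiLevelBlocks (cubes)
open B6Geom246MultiLevelBox (bset blkOf)
open B6Geom246MultiLevelTorus (geomT bondT lemma21_torus triangle_refl_nonneg_T)
open B8Ineq192MultiLevelTorus (geomTB geomTB_len geomTB_M geomTB_dist)
open B6RandomWalk (HasMajorant hasMajorant_mono BlockSupp)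
open B6Prop26Gluing (mulOp mulOp_apply LocalMajorant OutLoc InLoc ind ind_nonneg)
open B6Ineq261LevelGap (K261 K261_nonneg)
open B6Ineq2133TwoScaleV1 (onFun)
open B6GlobalChartV1 (PV toBox domT blkV1)
open B6SectAOperatorsV1 (dE dsE dcE dcsE QE aE QsE RE BondIdx)
open B6SectAVectorModelV1 (deltaAE GE)
open B6AgreeLapV1Chart (deltaAE_split)
open B6Partition118KLevelTorusCentral (QT QbigT zetaT zetaT_nonneg zetaT_le_one not_mem_QbigT_of_zetaT_ne_one one_le_of_four_le)
open B6Partition118KLevelTorusBinders (sLipT sLipT_nonneg abs_hT_sub_le_distT gap_QT)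
open B6Prop26KLevelSkeletonV1 (hB zB ST pref pref_nonneg abs_hB_le_one blkV1_mem_QT_of_hB_ne_zero sum_mulOp_hB_sq mulOp_zB_mul_hB mulOp_hB_mul_zB)
open B6Prop26KLevelSkeletonV2 (SbigT hNov_SbigT_of_QbigT ST_subset_SbigT blkV1_mem_SbigT_of_zB_ne_zero)
open B6InMajorantTransplant (InMajorant inMajorant_mono inMajorant_smul InMajorant.localMajorant)
open B6InDecayWindowV1 (OutMajorant outMajorant_mono outMajorant_smul)
open B6CubeWindowV1 (Placed Gl Ml Pl GlobalBand band_of_global band_le one_le_of_eight_le four_le_of_five_le)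
open B6CubeInDecayV1 (hGin_cube hNin_cube hNout_cube hPlin_cube hPlout_cube)
open B6CubeRightLegsV1 (hGEin_cube hGout_cube)
open B6Eq292MemberTorusV1 (EC cfC c0C NC zC abs_zC_le)
open B6Dg288ChartV1 (hasMajorant_Dg_V1_TB)
open B6Prop26KLevelAssemblyV1 (hasMajorant_smul mulOp_const_mul small_of_small_two sq_mul_pref inv_sq_mul_pref_inv lenTB_pos distT_nonneg
  hasMajorant_TB hasMajorant_T_of_TB inMajorant_TB localMajorant_TB outMajorant_TB)
open B6Prop26LeftEntryKLevelV1 (ind_mono)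
open B6Eq291Transpose (kFamT kFamT_smul eq291T_sum)
open B6Ineq2134TransposeDiag (hasMajorant_left_of_out)
open B6Ineq2134TransposeKLevelTorus (h2134T_kFamT_torus)
open B6OpTransposeV1 (hagreeT_cube hinvT_cube hdecT_cube inLoc_hB_Ml onFun_deltaAE_mul_GE)
open B6Prop26RightChainGeneric (prop26_rightEntry_of_2133T_2134T)
open B6CubeCoeffSizesV1 (abs_cfC_le cfC_supp abs_c0C_le c0C_supp)
open B6Partition118KLevelFineSizes (C1F C1F_nonneg)
open B6Partition118KLevelFineSecond (C2F C2F_nonneg)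
open B6Cover236QbigOverlapV1 (card_filter_mem_QbigT_le)
open B6Ineq2134TKFamKLevelExportV1 (hdecT_smul inLoc_smul inLoc_TB)

variable {d ℓ : ℕ} {hd : 1 ≤ d + 1} {hL : Odd (ℓ + 1) ∧ 1 < ℓ + 1} {m K : ℕ} {Mh k R : ℕ} {P' : Fin (d + 1) → ℕ}

/-! ## §1  Small algebra — now the tree's `B6Ineq2134TKFamKLevelExportV1.hdecT_smul` / `inLoc_smul` / `inLoc_TB` (p22's FILE K copied this file's §1
verbatim and landed first, 2026-08-25T03:03Z; reused BY NAME, not restated) -/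

/-! ## §2  The assembly of the transposed walk -/

section Assembly

/-- rate weakening of an exponential kernel. [folklore] -/
private theorem exp_le_exp_of_rate {ρ σ t : ℝ} (h : σ ≤ ρ) (ht : 0 ≤ t) : Real.exp (-(ρ * t)) ≤ Real.exp (-(σ * t)) :=
  Real.exp_le_exp.2 (by nlinarith)

set_option maxHeartbeats 1600000 in
open Classical in
/-- **PROPOSITION 2.6, THE RIGHT-FACTOR ENTRIES AT k LEVELS FOR THE GENUINE G — THE ASSEMBLY OF THE TRANSPOSED WALK.**  For the genuine `(k+1)`-level
torus family (`L ≥ 5`, `M_h = L^a ≥ 8`, `R ≥ 2L²`, `P′ ≥ 5`, every cube placed, global band `b₀ ≤ w/c′² ≤ b₁`): there is `σ₀ > 0` such that for every rate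
`σ ∈ (0, σ₀]`, split `α`, Lemma-2.1 budget `N₀`, overlap count `Nbig`, line-1 sizes `s₁, s₂`, line-3ᵀ data `(C_D, c_D)` and first-leg constant `C_L` there
are `A, M₁` with: on every torus above threshold, for every right factor `D′` and input weight `P ≥ 0` whose FIRST LEGS `h_□G_□h_□D′` have the majorant
`1_{Q_□}(y)·C_L·e^{−2σd(y,y′)}·P(y′)` for every cube, and given the displayed overlap / sizes / line 3ᵀ,
`HasMajorant (G·D′) (A·e^{−(1−α)σ d(y,y′)}·P(y′))` with `A = 2·Nbig·C_L`.
[cite: Balaban1984PropagatorsII, Prop. 2.6 (2.136) p.247, (2.141) p.247, (2.133)–(2.135) p.247, (2.88)–(2.94) pp.238–239, Lemma 2.1 p.234] -/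
theorem prop26_2136T_kLevel_assembly_le (d ℓ : ℕ) (hd : 1 ≤ d + 1) (hL : Odd (ℓ + 1) ∧ 1 < ℓ + 1) {b₀ b₁ : ℝ} (hb₀ : 0 < b₀) (hb₁ : b₀ ≤ b₁) :
    ∃ σ₀ : ℝ, 0 < σ₀ ∧ ∀ (σ : ℝ), 0 < σ → σ ≤ σ₀ → ∀ (α : ℝ), 0 ≤ α → α ≤ 1 → ∀ (N₀ : ℕ), 0 < N₀ → ∀ (Nbig : ℕ) {s₁ s₂ CD cD CL : ℝ},
      0 ≤ s₁ → 0 ≤ s₂ → 0 ≤ CD → 0 < cD → 0 ≤ CL →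
    ∃ A M₁ : ℝ, 0 ≤ A ∧ 0 < M₁ ∧
    ∀ (m K : ℕ) {Mh k R : ℕ} {P' : Fin (d + 1) → ℕ}
      (hN : ∀ μ, N0 ℓ Mh k P' μ = (PV d ℓ m K hd hL).sitesPerDir 0) (D : TDomains d ℓ Mh k P' R) (hk : k ≤ m + K) (_ : 2 ≤ k)
      {a : ℕ} (hMha : Mh = (ℓ + 1) ^ a) (hM8 : 8 ≤ Mh) (_ : 2 * (ℓ + 1) ^ 2 ≤ R) (hP5 : ∀ μ, 5 ≤ P' μ) (_ : 4 ≤ ℓ)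
      (hpl : ∀ c : ↥(cubes D.toDomains), Placed ℓ k P' c.1)
      (_ : M₁ ≤ ((ℓ : ℝ) + 1) * Mh) (_ : N₀ + 1 ≤ R * ((ℓ + 1) * Mh))
      (_ : Real.exp (-(α * σ)) * ((ℓ : ℝ) + 1) ^ ((2 * (d + 1 : ℕ) : ℝ) / N₀) < 1)
      {cf : ℝ} (hcf : cf ≠ 0) {w : BondIdx (domT hN D hk) → ℝ} (hw : ∀ i, 0 < w i) (_ : GlobalBand b₀ b₁ cf w)
      -- the overlap count of the `□̃`
      (_ : ∀ y : (geomT D).Site, (Finset.univ.filter fun c : ↥(cubes D.toDomains) =>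
        y ∈ QbigT D (one_le_of_eight_le hM8) (four_le_of_five_le hP5) c).card ≤ Nbig)
      -- the line-1 coefficients: sizes and supports
      (_ : ∀ (c : ↥(cubes D.toDomains)) (e : Fin (d + 1) × Bool) (x : PBond (PV d ℓ m K hd hL) 0),
        |cfC hN hk (one_le_of_eight_le hM8) (four_le_of_five_le hP5) hMha c (band_le (d := d) (ℓ := ℓ) hb₀ hb₁) (hpl c) w cf e x| ≤
          s₁ * cf ^ 2 / ((geomTB D).M * (geomTB D).len (blkV1 hN D x) ^ 2))
      (_ : ∀ (c : ↥(cubes D.toDomains)) (e : Fin (d + 1) × Bool) (x : PBond (PV d ℓ m K hd hL) 0),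
        cfC hN hk (one_le_of_eight_le hM8) (four_le_of_five_le hP5) hMha c (band_le (d := d) (ℓ := ℓ) hb₀ hb₁) (hpl c) w cf e x ≠ 0 →
          blkV1 hN D x ∈ ST D (one_le_of_eight_le hM8) (four_le_of_five_le hP5) c)
      (_ : ∀ (c : ↥(cubes D.toDomains)) (x : PBond (PV d ℓ m K hd hL) 0),
        |c0C hN hk (one_le_of_eight_le hM8) (four_le_of_five_le hP5) hMha c (band_le (d := d) (ℓ := ℓ) hb₀ hb₁) (hpl c) w cf x| ≤
          s₂ * cf ^ 2 / ((geomTB D).M * (geomTB D).len (blkV1 hN D x) ^ 2))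
      (_ : ∀ (c : ↥(cubes D.toDomains)) (x : PBond (PV d ℓ m K hd hL) 0),
        c0C hN hk (one_le_of_eight_le hM8) (four_le_of_five_le hP5) hMha c (band_le (d := d) (ℓ := ℓ) hb₀ hb₁) (hpl c) w cf x ≠ 0 →
          blkV1 hN D x ∈ ST D (one_le_of_eight_le hM8) (four_le_of_five_le hP5) c)
      -- line 3ᵀ (p22's `line3_cube_transpose` shape)
      (_ : ∀ c : ↥(cubes D.toDomains), HasMajorant (g := geomTB D) (blkV1 hN D)
        (mulOp (hB hN D c) *
          (onFun (dE (P := PV d ℓ m K hd hL) cf ∘ₗ (LinearMap.id - RE (domT hN D hk) cf) ∘ₗ dsE cf) -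
            Pl hN hk (one_le_of_eight_le hM8) (four_le_of_five_le hP5) hMha c (band_le (d := d) (ℓ := ℓ) hb₀ hb₁) (hpl c) w cf) *
          mulOp (zB hN D (one_le_of_eight_le hM8) (four_le_of_five_le hP5) c))
        (fun y y'' => CD * cf ^ 2 * Real.exp (-(cD * (geomTB D).M)) / (geomTB D).len y ^ 2 * Real.exp (-((2 * σ) * (geomTB D).dist y y''))))
      -- the right factor, the input weight, the first legs
      (D' : Module.End ℝ (PBond (PV d ℓ m K hd hL) 0 → ℝ)) (Pw : (geomT D).Site → ℝ) (_ : ∀ y, 0 ≤ Pw y)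
      (_ : ∀ c : ↥(cubes D.toDomains), HasMajorant (g := geomT D) (blkV1 hN D)
        (mulOp (hB hN D c) * Gl hN hk (one_le_of_eight_le hM8) (four_le_of_five_le hP5) hMha c (band_le (d := d) (ℓ := ℓ) hb₀ hb₁) (hpl c) w cf *
          mulOp (hB hN D c) * D')
        (fun y y' => ind (ST D (one_le_of_eight_le hM8) (four_le_of_five_le hP5) c) y * (CL * Real.exp (-((2 * σ) * (geomT D).dist y y')) * Pw y'))),
      HasMajorant (g := geomT D) (blkV1 hN D) (onFun (GE (domT hN D hk) hcf hw) * D')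
        (fun y y' => A * Real.exp (-((1 - α) * σ * (geomT D).dist y y')) * Pw y') := by
  -- ### constants of the member / global inputs (all on `d, L, b₀, b₁` only)
  have ha₀ : (0 : ℝ) < b₀ / ((ℓ + 1 : ℕ) : ℝ) := by positivity
  obtain ⟨ρG, hρG, CG, hCG, hGin⟩ := hGin_cube d ℓ hd hL ha₀ (band_le (d := d) (ℓ := ℓ) hb₀ hb₁)
  obtain ⟨ρE, hρE, CE, hCE, hGEin⟩ := hGEin_cube d ℓ hd hL ha₀ (band_le (d := d) (ℓ := ℓ) hb₀ hb₁)
  obtain ⟨ρH, hρH, CH, hCH, hGout⟩ := hGout_cube d ℓ hd hL ha₀ (band_le (d := d) (ℓ := ℓ) hb₀ hb₁)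
  obtain ⟨ρN, hρN, CN, hCN, hNin⟩ := hNin_cube d ℓ hd hL ha₀ (band_le (d := d) (ℓ := ℓ) hb₀ hb₁)
  obtain ⟨ρN', hρN', CN', hCN', hNout⟩ := hNout_cube d ℓ hd hL ha₀ (band_le (d := d) (ℓ := ℓ) hb₀ hb₁)
  obtain ⟨ρP, hρP, CP, hCP, hPlin⟩ := hPlin_cube d ℓ hd hL ha₀ (band_le (d := d) (ℓ := ℓ) hb₀ hb₁)
  obtain ⟨ρP', hρP', CP', hCP', hPlout⟩ := hPlout_cube d ℓ hd hL ha₀ (band_le (d := d) (ℓ := ℓ) hb₀ hb₁)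
  obtain ⟨M₃, δ₂, C₂, hM₃, hδ₂, hC₂, hDg⟩ := hasMajorant_Dg_V1_TB d ℓ hd hL
  -- the common rate `ρ = 2σ₀` of the (2.134)ᵀ inputs
  obtain ⟨ρ, hρ, hρG', hρE', hρH', hρN1, hρN2, hρP1, hρP2, hρD⟩ :
      ∃ ρ : ℝ, 0 < ρ ∧ ρ ≤ ρG ∧ ρ ≤ ρE ∧ ρ ≤ ρH ∧ ρ ≤ ρN ∧ ρ ≤ ρN' ∧ ρ ≤ ρP ∧ ρ ≤ ρP' ∧ ρ ≤ δ₂ := by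
    refine ⟨min (min ρG ρE) (min (min ρH ρN) (min (min ρN' ρP) (min ρP' δ₂))),
      lt_min (lt_min hρG hρE) (lt_min (lt_min hρH hρN) (lt_min (lt_min hρN' hρP) (lt_min hρP' hδ₂))), ?_, ?_, ?_, ?_, ?_, ?_, ?_, ?_⟩
    · exact (min_le_left _ _).trans (min_le_left _ _)
    · exact (min_le_left _ _).trans (min_le_right _ _)
    · exact (min_le_right _ _).trans ((min_le_left _ _).trans (min_le_left _ _))
    · exact (min_le_right _ _).trans ((min_le_left _ _).trans (min_le_right _ _))
    · exact (min_le_right _ _).trans ((min_le_right _ _).trans ((min_le_left _ _).trans (min_le_left _ _)))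
    · exact (min_le_right _ _).trans ((min_le_right _ _).trans ((min_le_left _ _).trans (min_le_right _ _)))
    · exact (min_le_right _ _).trans ((min_le_right _ _).trans ((min_le_right _ _).trans (min_le_left _ _)))
    · exact (min_le_right _ _).trans ((min_le_right _ _).trans ((min_le_right _ _).trans (min_le_right _ _)))
  refine ⟨ρ / 2, by positivity, ?_⟩
  intro σ hσ0 hσle α hα0 hα1 N₀ hN₀ Nbig s₁ s₂ CD cD CL hs₁ hs₂ hCD hcD hCL
  have h2σ : 2 * σ ≤ ρ := by linarith
  have h2σ0 : 0 < 2 * σ := by positivity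
  -- one constant for the four `N`/`P` majorants
  obtain ⟨CNN, hCNN0, hCN1, hCN2, hCP1, hCP2⟩ : ∃ CNN : ℝ, 0 ≤ CNN ∧ CN ≤ CNN ∧ CN' ≤ CNN ∧ CP ≤ CNN ∧ CP' ≤ CNN :=
    ⟨max (max CN CN') (max CP CP'), le_max_of_le_left (le_max_of_le_left hCN), le_max_of_le_left (le_max_left _ _),
      le_max_of_le_left (le_max_right _ _), le_max_of_le_right (le_max_left _ _), le_max_of_le_right (le_max_right _ _)⟩
  have hK0 : 0 ≤ K261 N₀ (d + 1) ((ℓ : ℝ) + 1) 1 (α * σ) := K261_nonneg (by positivity) zero_le_one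
  -- p38's threshold and constant for the REVERSED kernels of the RESCALED family (all constants `c′`-free)
  obtain ⟨M₁, Θ, hM₁, hΘ, h38⟩ := h2134T_kFamT_torus d ℓ (δG := 2 * σ) h2σ0
  -- the `θ₀`-budget: `θ₀(M) = Θ·V/M`, `V = C_P·C_H/m + U`
  obtain ⟨V, hV⟩ : ∃ V : ℝ, V = ((d : ℝ) + 1) * C₂ * CH / (1 / (2 * ((ℓ : ℝ) + 1) ^ 2)) +
      ((Fintype.card (Fin (d + 1) × Bool) : ℕ) * (s₁ * CE) + s₂ * CG + ((1 : ℕ) + 1) * sLipT d ℓ * ((CNN + 1) * CH * (1 + 1)) + CD * CH / cD) :=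
    ⟨_, rfl⟩
  have hs := sLipT_nonneg d ℓ
  have hVnn : 0 ≤ V := by rw [hV]; positivity
  have hΘV : 0 ≤ Θ * V := mul_nonneg hΘ hVnn
  obtain ⟨Mbig, hMbig⟩ : ∃ Mb : ℝ, Mb = (Nbig : ℝ) * Nbig * (Θ * V) * (2 * K261 N₀ (d + 1) ((ℓ : ℝ) + 1) 1 (α * σ)) + 1 := ⟨_, rfl⟩
  have hprod0 : 0 ≤ (Nbig : ℝ) * Nbig * (Θ * V) * (2 * K261 N₀ (d + 1) ((ℓ : ℝ) + 1) 1 (α * σ)) :=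
    mul_nonneg (mul_nonneg (mul_nonneg (Nat.cast_nonneg _) (Nat.cast_nonneg _)) hΘV) (by linarith)
  have hMbig0 : 0 < Mbig := by rw [hMbig]; linarith
  have hA0 : 0 ≤ 2 * ((Nbig : ℝ) * CL) := by positivity
  refine ⟨2 * ((Nbig : ℝ) * CL), max (max M₁ M₃) Mbig, hA0, lt_max_of_lt_right hMbig0, ?_⟩
  intro m K Mh k R P' hN D hk hk2 a hMha hM8 hR2 hP5 hℓ hpl hM₁' hRM hθ cf hcf w hw hwb hNbig hcfA hcfT hc0A hc0T hD3 D' Pw hPw hleg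
  -- ### the torus
  have hMh1 : 1 ≤ Mh := one_le_of_eight_le hM8
  have hP4 : ∀ μ, 4 ≤ P' μ := four_le_of_five_le hP5
  have hP : ∀ μ, 1 ≤ P' μ := one_le_of_four_le hP4
  have hMh : 2 ≤ Mh := le_trans (by norm_num) hM8
  have hR : 2 * (ℓ + 1) ≤ R := le_trans (by nlinarith : 2 * (ℓ + 1) ≤ 2 * (ℓ + 1) ^ 2) hR2
  have hℓ1 : 1 ≤ ℓ := le_trans (by norm_num) hℓ
  have hLM : M₁ ≤ ((ℓ : ℝ) + 1) * Mh := le_trans ((le_max_left _ _).trans (le_max_left _ _)) hM₁'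
  have hLM₃ : M₃ ≤ ((ℓ : ℝ) + 1) * Mh := le_trans ((le_max_right _ _).trans (le_max_left _ _)) hM₁'
  have hLMbig : Mbig ≤ ((ℓ : ℝ) + 1) * Mh := le_trans (le_max_right _ _) hM₁'
  have hcf2 : cf ^ 2 ≠ 0 := pow_ne_zero 2 hcf
  have hcf2pos : 0 < cf ^ 2 := by positivity
  have habs2 : |cf ^ 2| = cf ^ 2 := abs_of_pos hcf2pos
  have habs2i : |(cf ^ 2)⁻¹| = (cf ^ 2)⁻¹ := abs_of_pos (inv_pos.2 hcf2pos)
  have hMpos : 0 < (geomTB D).M := by rw [geomTB_M]; positivity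
  have hMeq : (geomTB D).M = ((ℓ : ℝ) + 1) * Mh := by rw [geomTB_M]
  have hdnn : ∀ y y' : (geomT D).Site, 0 ≤ (geomT D).dist y y' := distT_nonneg
  obtain ⟨htri, _, _⟩ := triangle_refl_nonneg_T D hMh1 hP
  obtain ⟨_, h261, _, _⟩ := lemma21_torus D hMh1 hP hN₀ hRM hσ0.le hα0 hα1 hθ
  -- the global `∂(1 − R)∂*` (p22), rescaled by `c′⁻²`
  have hDg' : HasMajorant (g := geomTB D) (blkV1 hN D)
      ((cf ^ 2)⁻¹ • onFun (dE (P := PV d ℓ m K hd hL) cf ∘ₗ (LinearMap.id - RE (domT hN D hk) cf) ∘ₗ dsE cf))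
      (fun y y'' => ((d : ℝ) + 1) * C₂ / (geomTB D).len y ^ 2 * Real.exp (-((2 * σ) * (geomTB D).dist y y''))) := by
    refine hasMajorant_mono _ (hasMajorant_smul _ (hDg m K hN D hk hMh1 hP4 hR hLM₃ hcf) _) fun y y'' => ?_
    rw [habs2i]
    have hl := lenTB_pos (D := D) y
    calc (cf ^ 2)⁻¹ * (cf ^ 2 * ((d : ℝ) + 1) * C₂ / (geomTB D).len y ^ 2 * Real.exp (-(δ₂ * (geomTB D).dist y y'')))
        = ((d : ℝ) + 1) * C₂ / (geomTB D).len y ^ 2 * Real.exp (-(δ₂ * (geomTB D).dist y y'')) := by field_simp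
      _ ≤ ((d : ℝ) + 1) * C₂ / (geomTB D).len y ^ 2 * Real.exp (-((2 * σ) * (geomTB D).dist y y'')) :=
          mul_le_mul_of_nonneg_left (exp_le_exp_of_rate (h2σ.trans hρD) (hdnn y y'')) (by positivity)
  -- ### p38's mirrored (2.134) for the rescaled family
  have H := h38 D hMh1 hP hR hLM (blkV1 hN D) (CP := ((d : ℝ) + 1) * C₂) (by positivity) hDg'
    (CG := CG) (CH := CH) (C₁ := CE) (CN := CNN) (CD := CD) (cD := cD) (s := sLipT d ℓ) (s₁ := s₁) (s₂ := s₂) (r₀ := 1)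
    (m := 1 / (2 * ((ℓ : ℝ) + 1) ^ 2)) hCG hCH hCE hCNN0 hCD hcD hs hs₁ hs₂ zero_le_one (by positivity)
    (Fintype.card (Fin (d + 1) × Bool)) 1 (Finset.univ : Finset ↥(cubes D.toDomains))
    (G := fun c => cf ^ 2 • Gl hN hk hMh1 hP4 hMha c (band_le (d := d) (ℓ := ℓ) hb₀ hb₁) (hpl c) w cf)
    (Ml := fun c => (cf ^ 2)⁻¹ • Ml hN hk hMh1 hP4 hMha c (band_le (d := d) (ℓ := ℓ) hb₀ hb₁) (hpl c) w cf)
    (Pl := fun c => (cf ^ 2)⁻¹ • Pl hN hk hMh1 hP4 hMha c (band_le (d := d) (ℓ := ℓ) hb₀ hb₁) (hpl c) w cf)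
    (h := fun c => hB hN D c) (ζ := fun c => zB hN D hMh1 hP4 c)
    (c₀ := fun c x => (cf ^ 2)⁻¹ * c0C hN hk hMh1 hP4 hMha c (band_le (d := d) (ℓ := ℓ) hb₀ hb₁) (hpl c) w cf x)
    (T := fun c => ST D hMh1 hP4 c) (S := fun c => ST D hMh1 hP4 c) (U := fun c => SbigT D hMh1 hP4 c) (Score := fun c => SbigT D hMh1 hP4 c)
    (DE := fun _ => (Finset.univ : Finset (Fin (d + 1) × Bool)))
    (E := fun c e => EC hN hk hMh1 hP4 hMha c (band_le (d := d) (ℓ := ℓ) hb₀ hb₁) (hpl c) w cf (e.1, !e.2))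
    (cf := fun c e x => (cf ^ 2)⁻¹ * cfC hN hk hMh1 hP4 hMha c (band_le (d := d) (ℓ := ℓ) hb₀ hb₁) (hpl c) w cf e x)
    (DK := fun _ => ({()} : Finset Unit))
    (N := fun c _ => (cf ^ 2)⁻¹ • NC hN hk hMh1 hP4 hMha c (band_le (d := d) (ℓ := ℓ) hb₀ hb₁) (hpl c) w cf)
    (z := fun c _ => zC hN hk hMh1 hP4 hMha c (band_le (d := d) (ℓ := ℓ) hb₀ hb₁) (hpl c) w cf)
    -- hnE, hnK
    (fun c _ => le_of_eq Finset.card_univ) (fun c _ => by simp)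
    -- hdecT (p38's `hdecT_cube`, rescaled)
    (fun c _ => hdecT_smul Finset.univ ({()} : Finset Unit)
      (N := fun _ => NC hN hk hMh1 hP4 hMha c (band_le (d := d) (ℓ := ℓ) hb₀ hb₁) (hpl c) w cf)
      (z := fun _ => zC hN hk hMh1 hP4 hMha c (band_le (d := d) (ℓ := ℓ) hb₀ hb₁) (hpl c) w cf)
      (hdecT_cube hN hk hMh1 hP4 hMha c (band_le (d := d) (ℓ := ℓ) hb₀ hb₁) ha₀ hM8 hR2 (hpl c) w cf) _)
    -- hG (r03's `hGin_cube`)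
    (fun c _ => by
      refine localMajorant_TB hN (inMajorant_mono (g := geomT D) _
        (inMajorant_smul _ (hGin m K hN D hk hMh1 hP4 hMha hMh hR2 hℓ c (hpl c) w cf) (cf ^ 2))
        (K' := fun (y y' : (geomT D).Site) => CG * (geomTB D).len y ^ 2 * Real.exp (-((2 * σ) * (geomT D).dist y y'))) fun y y' _ => ?_).localMajorant
      rw [habs2, ← sq_mul_pref cf hcf y]
      have := pref_nonneg cf y
      calc cf ^ 2 * (CG * pref cf y * Real.exp (-(ρG * (geomT D).dist y y')))
          = CG * (cf ^ 2 * pref cf y) * Real.exp (-(ρG * (geomT D).dist y y')) := by ring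
        _ ≤ CG * (cf ^ 2 * pref cf y) * Real.exp (-((2 * σ) * (geomT D).dist y y')) :=
            mul_le_mul_of_nonneg_left (exp_le_exp_of_rate (h2σ.trans hρG') (hdnn y y')) (by positivity))
    -- hGE (p22's `hGEin_cube`, the right legs)
    (fun c _ e _ => by
      have hx := inMajorant_mono (g := geomT D) _
        (inMajorant_smul _ (hGEin m K hN D hk hMh1 hP4 hMha hMh hR2 hℓ c (hpl c) w cf (e.1, !e.2)) (cf ^ 2))
        (K' := fun (y y' : (geomT D).Site) => CE * (geomTB D).len y ^ 2 * Real.exp (-((2 * σ) * (geomT D).dist y y'))) fun y y' _ => by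
          rw [habs2, ← sq_mul_pref cf hcf y]
          have := pref_nonneg cf y
          calc cf ^ 2 * (CE * pref cf y * Real.exp (-(ρE * (geomT D).dist y y')))
              = CE * (cf ^ 2 * pref cf y) * Real.exp (-(ρE * (geomT D).dist y y')) := by ring
            _ ≤ CE * (cf ^ 2 * pref cf y) * Real.exp (-((2 * σ) * (geomT D).dist y y')) :=
                mul_le_mul_of_nonneg_left (exp_le_exp_of_rate (h2σ.trans hρE') (hdnn y y')) (by positivity)
      rw [← smul_mul_assoc] at hx
      exact localMajorant_TB hN hx.localMajorant)
    -- hHG (p22's `hGout_cube`: `h_□G_□` as a global operator)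
    (fun c _ => by
      have hx : HasMajorant (g := geomT D) (blkV1 hN D) (mulOp (hB hN D c) * Gl hN hk hMh1 hP4 hMha c (band_le (d := d) (ℓ := ℓ) hb₀ hb₁) (hpl c) w cf)
          (fun y y' => CH * pref cf y * Real.exp (-(ρH * (geomT D).dist y y'))) :=
        hasMajorant_left_of_out (blkV1 hN D) (fun y y' => by have := pref_nonneg cf y; positivity)
          (fun y' μ B hμ x hx => hGout m K hN D hk hMh1 hP4 hMha hMh hR2 hℓ c (hpl c) w cf y' μ B hμ x hx)
          (fun x hx => blkV1_mem_QT_of_hB_ne_zero hN D hMh hR hP4 c hx)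
          (fun x => abs_hB_le_one hN D hMh1 hP c x)
      have hx2 := hasMajorant_smul _ hx (cf ^ 2)
      rw [← mul_smul_comm] at hx2
      refine hasMajorant_TB hN (hasMajorant_mono (g := geomT D) _ hx2 fun y y' => ?_)
      rw [habs2, ← sq_mul_pref cf hcf y]
      have := pref_nonneg cf y
      calc cf ^ 2 * (CH * pref cf y * Real.exp (-(ρH * (geomT D).dist y y')))
          = CH * (cf ^ 2 * pref cf y) * Real.exp (-(ρH * (geomT D).dist y y')) := by ring
        _ ≤ CH * (cf ^ 2 * pref cf y) * Real.exp (-((2 * σ) * (geomT D).dist y y')) :=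
            mul_le_mul_of_nonneg_left (exp_le_exp_of_rate (h2σ.trans hρH') (hdnn y y')) (by positivity))
    -- hcf, hcfS
    (fun c _ e _ x => by
      have hl := lenTB_pos (D := D) (blkV1 hN D x)
      rw [abs_mul, habs2i]
      calc (cf ^ 2)⁻¹ * |cfC hN hk hMh1 hP4 hMha c (band_le (d := d) (ℓ := ℓ) hb₀ hb₁) (hpl c) w cf e x|
          ≤ (cf ^ 2)⁻¹ * (s₁ * cf ^ 2 / ((geomTB D).M * (geomTB D).len (blkV1 hN D x) ^ 2)) :=
            mul_le_mul_of_nonneg_left (hcfA c e x) (by positivity)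
        _ = s₁ / ((geomTB D).M * (geomTB D).len (blkV1 hN D x) ^ 2) := by field_simp)
    (fun c _ e _ x hx => hcfT c e x (right_ne_zero_of_mul hx))
    -- hc₀, hc₀S
    (fun c _ x => by
      have hl := lenTB_pos (D := D) (blkV1 hN D x)
      rw [abs_mul, habs2i]
      calc (cf ^ 2)⁻¹ * |c0C hN hk hMh1 hP4 hMha c (band_le (d := d) (ℓ := ℓ) hb₀ hb₁) (hpl c) w cf x|
          ≤ (cf ^ 2)⁻¹ * (s₂ * cf ^ 2 / ((geomTB D).M * (geomTB D).len (blkV1 hN D x) ^ 2)) :=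
            mul_le_mul_of_nonneg_left (hc0A c x) (by positivity)
        _ = s₂ / ((geomTB D).M * (geomTB D).len (blkV1 hN D x) ^ 2) := by field_simp)
    (fun c _ x hx => hc0T c x (right_ne_zero_of_mul hx))
    -- hh1, hhS, hST, hSU, hLip
    (fun c _ x => abs_hB_le_one hN D hMh1 hP c x)
    (fun c _ x hx => blkV1_mem_QT_of_hB_ne_zero hN D hMh hR hP4 c hx)
    (fun c _ => fun _ hy => hy)
    (fun c _ => ST_subset_SbigT D hMh1 hP4 c)
    (fun c _ x x' => abs_hT_sub_le_distT hℓ1 hMh hR hP5 c (toBox hN x.src) (toBox hN x'.src))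
    -- hNin, hNout
    (fun c _ k _ => by
      refine inMajorant_TB hN (inMajorant_mono (g := geomT D) _ (inMajorant_smul _ (hNin m K hN D hk hMh1 hP4 hMha hMh hR2 hℓ c (hpl c) w cf) ((cf ^ 2)⁻¹))
        (K' := fun (y y'' : (geomT D).Site) => CNN / (geomTB D).len y ^ 2 * Real.exp (-((2 * σ) * (geomT D).dist y y''))) fun y y'' _ => ?_)
      rw [habs2i]
      have hl := lenTB_pos (D := D) y
      calc (cf ^ 2)⁻¹ * (CN * (pref cf y)⁻¹ * Real.exp (-(ρN * (geomT D).dist y y'')))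
          = CN * ((cf ^ 2)⁻¹ * (pref cf y)⁻¹) * Real.exp (-(ρN * (geomT D).dist y y'')) := by ring
        _ = CN / (geomTB D).len y ^ 2 * Real.exp (-(ρN * (geomT D).dist y y'')) := by rw [inv_sq_mul_pref_inv cf hcf y]; ring
        _ ≤ CNN / (geomTB D).len y ^ 2 * Real.exp (-((2 * σ) * (geomT D).dist y y'')) :=
            mul_le_mul (div_le_div_of_nonneg_right hCN1 (by positivity)) (exp_le_exp_of_rate (h2σ.trans hρN1) (hdnn y y''))
              (Real.exp_nonneg _) (by positivity))
    (fun c _ k _ => by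
      have hx := outMajorant_mono (g := geomT D) _ (outMajorant_smul _ (hNout m K hN D hk hMh1 hP4 hMha hMh hR2 hℓ c (hpl c) w cf) ((cf ^ 2)⁻¹))
        (K' := fun (y y'' : (geomT D).Site) => CNN / (geomTB D).len y ^ 2 * Real.exp (-((2 * σ) * (geomT D).dist y y''))) fun y _ y'' => by
          rw [habs2i]
          have hl := lenTB_pos (D := D) y
          calc (cf ^ 2)⁻¹ * (CN' * (pref cf y)⁻¹ * Real.exp (-(ρN' * (geomT D).dist y y'')))
              = CN' * ((cf ^ 2)⁻¹ * (pref cf y)⁻¹) * Real.exp (-(ρN' * (geomT D).dist y y'')) := by ring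
            _ = CN' / (geomTB D).len y ^ 2 * Real.exp (-(ρN' * (geomT D).dist y y'')) := by rw [inv_sq_mul_pref_inv cf hcf y]; ring
            _ ≤ CNN / (geomTB D).len y ^ 2 * Real.exp (-((2 * σ) * (geomT D).dist y y'')) :=
                mul_le_mul (div_le_div_of_nonneg_right hCN2 (by positivity)) (exp_le_exp_of_rate (h2σ.trans hρN2) (hdnn y y''))
                  (Real.exp_nonneg _) (by positivity)
      exact outMajorant_TB hN hx)
    -- hz
    (fun c _ k _ x => abs_zC_le hN hk hMh1 hP4 hMha c (band_le (d := d) (ℓ := ℓ) hb₀ hb₁) (hpl c) w cf x)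
    -- hMin (p38's `inLoc_hB_Ml`, rescaled)
    (fun c _ => by
      have hx := inLoc_smul (g := geomT D) (blkV1 hN D)
        (inLoc_hB_Ml hN hk hMh1 hP4 hMha c (band_le (d := d) (ℓ := ℓ) hb₀ hb₁) ha₀ hM8 hR2 hP5 (hpl c) w cf (hcfT c) (hc0T c)) ((cf ^ 2)⁻¹)
      rw [← mul_smul_comm] at hx
      exact inLoc_TB hN hx)
    -- hPlin, hPlout
    (fun c _ => by
      refine inMajorant_TB hN (inMajorant_mono (g := geomT D) _ (inMajorant_smul _ (hPlin m K hN D hk hMh1 hP4 hMha hMh hR2 hℓ c (hpl c) w cf) ((cf ^ 2)⁻¹))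
        (K' := fun (y y'' : (geomT D).Site) => CNN / (geomTB D).len y ^ 2 * Real.exp (-((2 * σ) * (geomT D).dist y y''))) fun y y'' _ => ?_)
      rw [habs2i]
      have hl := lenTB_pos (D := D) y
      calc (cf ^ 2)⁻¹ * (CP * (pref cf y)⁻¹ * Real.exp (-(ρP * (geomT D).dist y y'')))
          = CP * ((cf ^ 2)⁻¹ * (pref cf y)⁻¹) * Real.exp (-(ρP * (geomT D).dist y y'')) := by ring
        _ = CP / (geomTB D).len y ^ 2 * Real.exp (-(ρP * (geomT D).dist y y'')) := by rw [inv_sq_mul_pref_inv cf hcf y]; ring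
        _ ≤ CNN / (geomTB D).len y ^ 2 * Real.exp (-((2 * σ) * (geomT D).dist y y'')) :=
            mul_le_mul (div_le_div_of_nonneg_right hCP1 (by positivity)) (exp_le_exp_of_rate (h2σ.trans hρP1) (hdnn y y''))
              (Real.exp_nonneg _) (by positivity))
    (fun c _ => by
      have hx := outMajorant_mono (g := geomT D) _ (outMajorant_smul _ (hPlout m K hN D hk hMh1 hP4 hMha hMh hR2 hℓ c (hpl c) w cf) ((cf ^ 2)⁻¹))
        (K' := fun (y y'' : (geomT D).Site) => CNN / (geomTB D).len y ^ 2 * Real.exp (-((2 * σ) * (geomT D).dist y y''))) fun y _ y'' => by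
          rw [habs2i]
          have hl := lenTB_pos (D := D) y
          calc (cf ^ 2)⁻¹ * (CP' * (pref cf y)⁻¹ * Real.exp (-(ρP' * (geomT D).dist y y'')))
              = CP' * ((cf ^ 2)⁻¹ * (pref cf y)⁻¹) * Real.exp (-(ρP' * (geomT D).dist y y'')) := by ring
            _ = CP' / (geomTB D).len y ^ 2 * Real.exp (-(ρP' * (geomT D).dist y y'')) := by rw [inv_sq_mul_pref_inv cf hcf y]; ring
            _ ≤ CNN / (geomTB D).len y ^ 2 * Real.exp (-((2 * σ) * (geomT D).dist y y'')) :=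
                mul_le_mul (div_le_div_of_nonneg_right hCP2 (by positivity)) (exp_le_exp_of_rate (h2σ.trans hρP2) (hdnn y y''))
                  (Real.exp_nonneg _) (by positivity)
      exact outMajorant_TB hN hx)
    -- hζ0, hζ1, hζU, hζS
    (fun c _ x => zetaT_nonneg hMh1 hP4 c (toBox hN x.src)) (fun c _ x => zetaT_le_one hMh1 hP4 c (toBox hN x.src))
    (fun c _ x hx => blkV1_mem_SbigT_of_zB_ne_zero hN D hMh1 hP4 c hx)
    (fun c _ x hx => not_mem_QbigT_of_zetaT_ne_one hMh1 hP4 c hx)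
    -- hD3ᵀ (rescaled)
    (fun c _ => by
      have hx := hasMajorant_smul _ (hD3 c) ((cf ^ 2)⁻¹)
      have eop : (cf ^ 2)⁻¹ • (mulOp (hB hN D c) *
            (onFun (dE (P := PV d ℓ m K hd hL) cf ∘ₗ (LinearMap.id - RE (domT hN D hk) cf) ∘ₗ dsE cf) -
              Pl hN hk hMh1 hP4 hMha c (band_le (d := d) (ℓ := ℓ) hb₀ hb₁) (hpl c) w cf) * mulOp (zB hN D hMh1 hP4 c)) =
          mulOp (hB hN D c) *
            ((cf ^ 2)⁻¹ • onFun (dE (P := PV d ℓ m K hd hL) cf ∘ₗ (LinearMap.id - RE (domT hN D hk) cf) ∘ₗ dsE cf) -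
              (cf ^ 2)⁻¹ • Pl hN hk hMh1 hP4 hMha c (band_le (d := d) (ℓ := ℓ) hb₀ hb₁) (hpl c) w cf) * mulOp (zB hN D hMh1 hP4 c) := by
        simp only [smul_sub, mul_sub, sub_mul, mul_smul_comm, smul_mul_assoc]
      rw [eop] at hx
      refine hasMajorant_mono _ hx fun y y'' => le_of_eq ?_
      rw [habs2i]
      have hl := lenTB_pos (D := D) y
      field_simp)
    -- hgap (read from the input side: the torus distance is symmetric)
    (fun c _ y'' b hy'' hb => by
      have hg := gap_QT hℓ1 hMh hR hP5 c hb hy''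
      rw [SimpleGraph.dist_comm] at hg
      exact hg)
  -- ### back to the TRUE family: `h·(c′²G_□)·(c′⁻²K̃) = h·G_□·K̃`
  have h2134T : ∀ c c' : ↥(cubes D.toDomains), HasMajorant (g := geomT D) (blkV1 hN D)
      (mulOp (hB hN D c') * Gl hN hk hMh1 hP4 hMha c' (band_le (d := d) (ℓ := ℓ) hb₀ hb₁) (hpl c') w cf *
        kFamT (onFun (dE (P := PV d ℓ m K hd hL) cf ∘ₗ (LinearMap.id - RE (domT hN D hk) cf) ∘ₗ dsE cf))
          (fun c => mulOp (hB hN D c)) (fun c => mulOp (zB hN D hMh1 hP4 c))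
          (fun c => Ml hN hk hMh1 hP4 hMha c (band_le (d := d) (ℓ := ℓ) hb₀ hb₁) (hpl c) w cf)
          (fun c => Pl hN hk hMh1 hP4 hMha c (band_le (d := d) (ℓ := ℓ) hb₀ hb₁) (hpl c) w cf) c c')
      (fun y y' => ind (SbigT D hMh1 hP4 c') y * ind (SbigT D hMh1 hP4 c) y' * (Θ * V * ((geomTB D).M)⁻¹ * Real.exp (-(σ * (geomT D).dist y y')))) := by
    intro c c'
    have h := H c (Finset.mem_univ _) c' (Finset.mem_univ _)
    have eK : mulOp (hB hN D c') * (cf ^ 2 • Gl hN hk hMh1 hP4 hMha c' (band_le (d := d) (ℓ := ℓ) hb₀ hb₁) (hpl c') w cf) *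
        kFamT ((cf ^ 2)⁻¹ • onFun (dE (P := PV d ℓ m K hd hL) cf ∘ₗ (LinearMap.id - RE (domT hN D hk) cf) ∘ₗ dsE cf))
          (fun c => mulOp (hB hN D c)) (fun c => mulOp (zB hN D hMh1 hP4 c))
          (fun c => (cf ^ 2)⁻¹ • Ml hN hk hMh1 hP4 hMha c (band_le (d := d) (ℓ := ℓ) hb₀ hb₁) (hpl c) w cf)
          (fun c => (cf ^ 2)⁻¹ • Pl hN hk hMh1 hP4 hMha c (band_le (d := d) (ℓ := ℓ) hb₀ hb₁) (hpl c) w cf) c c' =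
        mulOp (hB hN D c') * Gl hN hk hMh1 hP4 hMha c' (band_le (d := d) (ℓ := ℓ) hb₀ hb₁) (hpl c') w cf *
        kFamT (onFun (dE (P := PV d ℓ m K hd hL) cf ∘ₗ (LinearMap.id - RE (domT hN D hk) cf) ∘ₗ dsE cf))
          (fun c => mulOp (hB hN D c)) (fun c => mulOp (zB hN D hMh1 hP4 c))
          (fun c => Ml hN hk hMh1 hP4 hMha c (band_le (d := d) (ℓ := ℓ) hb₀ hb₁) (hpl c) w cf)
          (fun c => Pl hN hk hMh1 hP4 hMha c (band_le (d := d) (ℓ := ℓ) hb₀ hb₁) (hpl c) w cf) c c' := by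
      rw [kFamT_smul]
      simp only [mul_smul_comm, smul_mul_assoc, smul_smul]
      rw [inv_mul_cancel₀ hcf2, one_smul]
    rw [eK] at h
    refine hasMajorant_T_of_TB hN (hasMajorant_mono (g := geomTB D) (blkV1 hN D) h fun y y' => le_of_eq ?_)
    rw [hV, geomTB_dist, show (2 * σ) / 2 = σ by ring]
    rfl
  -- ### (2.91)ᵀ for the genuine operators (`h_□·` , `M_□`, `P_□`, `G_□` symmetric: p38's `hagreeT_cube`, `hinvT_cube`)
  have h291T : (∑ c ∈ (Finset.univ : Finset ↥(cubes D.toDomains)),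
      mulOp (hB hN D c) * Gl hN hk hMh1 hP4 hMha c (band_le (d := d) (ℓ := ℓ) hb₀ hb₁) (hpl c) w cf * mulOp (hB hN D c)) *
        onFun (deltaAE (domT hN D hk) cf w) =
      1 - ∑ c ∈ Finset.univ, ∑ c' ∈ Finset.univ,
        mulOp (hB hN D c') * Gl hN hk hMh1 hP4 hMha c' (band_le (d := d) (ℓ := ℓ) hb₀ hb₁) (hpl c') w cf *
          kFamT (onFun (dE (P := PV d ℓ m K hd hL) cf ∘ₗ (LinearMap.id - RE (domT hN D hk) cf) ∘ₗ dsE cf))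
            (fun c => mulOp (hB hN D c)) (fun c => mulOp (zB hN D hMh1 hP4 c))
            (fun c => Ml hN hk hMh1 hP4 hMha c (band_le (d := d) (ℓ := ℓ) hb₀ hb₁) (hpl c) w cf)
            (fun c => Pl hN hk hMh1 hP4 hMha c (band_le (d := d) (ℓ := ℓ) hb₀ hb₁) (hpl c) w cf) c c' := by
    rw [deltaAE_split]
    exact eq291T_sum Finset.univ _ _ (fun c => mulOp (hB hN D c)) (fun c => mulOp (zB hN D hMh1 hP4 c))
      (fun c => Gl hN hk hMh1 hP4 hMha c (band_le (d := d) (ℓ := ℓ) hb₀ hb₁) (hpl c) w cf)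
      (fun c => Ml hN hk hMh1 hP4 hMha c (band_le (d := d) (ℓ := ℓ) hb₀ hb₁) (hpl c) w cf)
      (fun c => Pl hN hk hMh1 hP4 hMha c (band_le (d := d) (ℓ := ℓ) hb₀ hb₁) (hpl c) w cf)
      (sum_mulOp_hB_sq hN D hMh1 hP)
      (fun c _ => hagreeT_cube hN hk hMh1 hP4 hMha c (band_le (d := d) (ℓ := ℓ) hb₀ hb₁) ha₀ hk2 hM8 hR2 (hpl c) w hcf
        (fun i hi _ => band_of_global hN hk hMh1 hP4 c (le_of_lt hb₀) hcf w hwb i hi))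
      (fun c _ => hinvT_cube hN hk hMh1 hP4 hMha c (band_le (d := d) (ℓ := ℓ) hb₀ hb₁) ha₀ hM8 hR2 (hpl c) w hcf)
      (fun c _ => mulOp_zB_mul_hB hN D hMh hR hP4 c) (fun c _ => mulOp_hB_mul_zB hN D hMh hR hP4 c)
  -- ### the smallness of `θ₀ = Θ·V/M` above `Mbig`
  have hMinv0 : 0 ≤ ((geomTB D).M)⁻¹ := inv_nonneg.2 hMpos.le
  have hθ₀nn : 0 ≤ Θ * V * ((geomTB D).M)⁻¹ := mul_nonneg hΘV hMinv0
  have hsmall2 : ((Nbig : ℝ) * Nbig * (Θ * V * ((geomTB D).M)⁻¹)) * (2 * K261 N₀ (d + 1) ((ℓ : ℝ) + 1) 1 (α * σ)) < 1 := by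
    have hMb : (Nbig : ℝ) * Nbig * (Θ * V) * (2 * K261 N₀ (d + 1) ((ℓ : ℝ) + 1) 1 (α * σ)) + 1 ≤ (geomTB D).M := by
      rw [hMeq, ← hMbig]; exact hLMbig
    have e : ((Nbig : ℝ) * Nbig * (Θ * V * ((geomTB D).M)⁻¹)) * (2 * K261 N₀ (d + 1) ((ℓ : ℝ) + 1) 1 (α * σ)) =
        ((Nbig : ℝ) * Nbig * (Θ * V) * (2 * K261 N₀ (d + 1) ((ℓ : ℝ) + 1) 1 (α * σ))) / (geomTB D).M := by
      rw [div_eq_mul_inv]; ring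
    rw [e, div_lt_one hMpos]
    linarith
  have hNNθ : 0 ≤ (Nbig : ℝ) * Nbig * (Θ * V * ((geomTB D).M)⁻¹) := mul_nonneg (mul_nonneg (Nat.cast_nonneg _) (Nat.cast_nonneg _)) hθ₀nn
  have hsmall : ((Nbig : ℝ) * Nbig * (Θ * V * ((geomTB D).M)⁻¹)) * K261 N₀ (d + 1) ((ℓ : ℝ) + 1) 1 (α * σ) < 1 := by
    have e : ((Nbig : ℝ) * Nbig * (Θ * V * ((geomTB D).M)⁻¹)) * (2 * K261 N₀ (d + 1) ((ℓ : ℝ) + 1) 1 (α * σ)) =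
        2 * (((Nbig : ℝ) * Nbig * (Θ * V * ((geomTB D).M)⁻¹)) * K261 N₀ (d + 1) ((ℓ : ℝ) + 1) 1 (α * σ)) := by ring
    rw [e] at hsmall2
    linarith [mul_nonneg hNNθ hK0]
  -- the final constant: `(1 − N²θ₀c)⁻¹ ≤ 2`
  have hinv2 : (1 - (Nbig : ℝ) * Nbig * (Θ * V * ((geomTB D).M)⁻¹) * K261 N₀ (d + 1) ((ℓ : ℝ) + 1) 1 (α * σ))⁻¹ ≤ 2 := by
    have hxlt : (Nbig : ℝ) * Nbig * (Θ * V * ((geomTB D).M)⁻¹) * K261 N₀ (d + 1) ((ℓ : ℝ) + 1) 1 (α * σ) < 1 / 2 :=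
      (lt_div_iff₀ two_pos).2 (by rw [mul_assoc, mul_comm (K261 N₀ (d + 1) ((ℓ : ℝ) + 1) 1 (α * σ)) 2]; exact hsmall2)
    have h1 : (1 : ℝ) / 2 ≤ 1 - (Nbig : ℝ) * Nbig * (Θ * V * ((geomTB D).M)⁻¹) * K261 N₀ (d + 1) ((ℓ : ℝ) + 1) 1 (α * σ) :=
      le_sub_comm.1 (by rw [show (1 : ℝ) - 1 / 2 = 1 / 2 by norm_num]; exact hxlt.le)
    calc (1 - (Nbig : ℝ) * Nbig * (Θ * V * ((geomTB D).M)⁻¹) * K261 N₀ (d + 1) ((ℓ : ℝ) + 1) 1 (α * σ))⁻¹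
        ≤ ((1 : ℝ) / 2)⁻¹ := inv_anti₀ (by norm_num) h1
      _ = 2 := by norm_num
  -- ### the first legs: indicator `1_{Q_□} ≤ 1_{□̃}`, rate `2σ ≥ σ`
  have h2133T : ∀ c ∈ (Finset.univ : Finset ↥(cubes D.toDomains)), HasMajorant (g := geomT D) (blkV1 hN D)
      (mulOp (hB hN D c) * Gl hN hk hMh1 hP4 hMha c (band_le (d := d) (ℓ := ℓ) hb₀ hb₁) (hpl c) w cf * mulOp (hB hN D c) * D')
      (fun y y' => ind (SbigT D hMh1 hP4 c) y * (CL * Real.exp (-(σ * (geomT D).dist y y')) * Pw y')) := by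
    intro c _
    refine hasMajorant_mono _ (hleg c) fun y y' => ?_
    have h1 := ind_mono (ST_subset_SbigT D hMh1 hP4 c) y
    have h2 := ind_nonneg (ST D hMh1 hP4 c) y
    have h3 : Real.exp (-((2 * σ) * (geomT D).dist y y')) ≤ Real.exp (-(σ * (geomT D).dist y y')) :=
      exp_le_exp_of_rate (by linarith) (hdnn y y')
    have h4 := hPw y'
    have h5 := Real.exp_nonneg (-((2 * σ) * (geomT D).dist y y'))
    calc ind (ST D hMh1 hP4 c) y * (CL * Real.exp (-((2 * σ) * (geomT D).dist y y')) * Pw y')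
        ≤ ind (ST D hMh1 hP4 c) y * (CL * Real.exp (-(σ * (geomT D).dist y y')) * Pw y') :=
          mul_le_mul_of_nonneg_left (mul_le_mul_of_nonneg_right (mul_le_mul_of_nonneg_left h3 hCL) h4) h2
      _ ≤ ind (SbigT D hMh1 hP4 c) y * (CL * Real.exp (-(σ * (geomT D).dist y y')) * Pw y') :=
          mul_le_mul_of_nonneg_right h1 (by positivity)
  -- ### the gluing (p38's LEFT chain with the prefactor at the input block)
  have hmain : HasMajorant (g := geomT D) (blkV1 hN D) (onFun (GE (domT hN D hk) hcf hw) * D')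
      (fun y y' => (Nbig : ℝ) * CL * (1 - (Nbig : ℝ) * Nbig * (Θ * V * ((geomTB D).M)⁻¹) * K261 N₀ (d + 1) ((ℓ : ℝ) + 1) 1 (α * σ))⁻¹ *
        Real.exp (-((1 - α) * σ * (geomT D).dist y y')) * Pw y') :=
    prop26_rightEntry_of_2133T_2134T (g := geomT D) (blkV1 hN D) (Finset.univ : Finset ↥(cubes D.toDomains))
    (fun c => SbigT D hMh1 hP4 c) (hNov_SbigT_of_QbigT D hMh1 hP4 hNbig) (K261 N₀ (d + 1) ((ℓ : ℝ) + 1) 1 (α * σ)) σ α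
    (Θ * V * ((geomTB D).M)⁻¹) CL Pw hCL hPw hθ₀nn hK0 hα0 hα1 hσ0.le htri hdnn h261 hsmall
    (G := onFun (GE (domT hN D hk) hcf hw)) (Δa := onFun (deltaAE (domT hN D hk) cf w)) (D' := D') (h := fun c => hB hN D c)
    (Gl := fun c => Gl hN hk hMh1 hP4 hMha c (band_le (d := d) (ℓ := ℓ) hb₀ hb₁) (hpl c) w cf)
    (Xt := fun c c' => mulOp (hB hN D c') * Gl hN hk hMh1 hP4 hMha c' (band_le (d := d) (ℓ := ℓ) hb₀ hb₁) (hpl c') w cf *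
      kFamT (onFun (dE (P := PV d ℓ m K hd hL) cf ∘ₗ (LinearMap.id - RE (domT hN D hk) cf) ∘ₗ dsE cf))
        (fun c => mulOp (hB hN D c)) (fun c => mulOp (zB hN D hMh1 hP4 c))
        (fun c => Ml hN hk hMh1 hP4 hMha c (band_le (d := d) (ℓ := ℓ) hb₀ hb₁) (hpl c) w cf)
        (fun c => Pl hN hk hMh1 hP4 hMha c (band_le (d := d) (ℓ := ℓ) hb₀ hb₁) (hpl c) w cf) c c')
    (onFun_deltaAE_mul_GE (domT hN D hk) hcf hw) h291T h2133T (fun c _ c' _ => h2134T c c')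
  -- ### the final constant: `(1 − N²θ₀c)⁻¹ ≤ 2`
  have hNC : 0 ≤ (Nbig : ℝ) * CL := mul_nonneg (Nat.cast_nonneg _) hCL
  refine hasMajorant_mono _ hmain fun y y' => ?_
  have hE := Real.exp_nonneg (-((1 - α) * σ * (geomT D).dist y y'))
  have hPy := hPw y'
  have hstep : (Nbig : ℝ) * CL * (1 - (Nbig : ℝ) * Nbig * (Θ * V * ((geomTB D).M)⁻¹) * K261 N₀ (d + 1) ((ℓ : ℝ) + 1) 1 (α * σ))⁻¹
      ≤ (Nbig : ℝ) * CL * 2 := mul_le_mul_of_nonneg_left hinv2 hNC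
  have e2 : (Nbig : ℝ) * CL * 2 = 2 * ((Nbig : ℝ) * CL) := by ring
  rw [← e2]
  exact mul_le_mul_of_nonneg_right (mul_le_mul_of_nonneg_right hstep hE) hPy

end Assembly

/-! ## §3  The overlap count and the line-1 sizes discharged: line 3ᵀ and the first legs remain displayed -/

section Final

open Classical in
/-- **THE RIGHT-FACTOR ENTRIES AT k LEVELS — OVERLAP AND LINE-1 SIZES DISCHARGED** (`Nbig = 3·9^{d+1}`, p21's `card_filter_mem_QbigT_le`; sizes and
supports by p38's `B6CubeCoeffSizesV1`): line 3ᵀ and the first legs displayed. [cite: Balaban1984PropagatorsII, Prop. 2.6 (2.136) p.247, (2.141) p.247,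
(2.92) p.239, (2.133)–(2.135) p.247] -/
theorem prop26_2136T_kLevel_final_le (d ℓ : ℕ) (hd : 1 ≤ d + 1) (hL : Odd (ℓ + 1) ∧ 1 < ℓ + 1) {b₀ b₁ : ℝ} (hb₀ : 0 < b₀) (hb₁ : b₀ ≤ b₁) :
    ∃ σ₀ : ℝ, 0 < σ₀ ∧ ∀ (σ : ℝ), 0 < σ → σ ≤ σ₀ → ∀ (α : ℝ), 0 ≤ α → α ≤ 1 → ∀ (N₀ : ℕ), 0 < N₀ → ∀ {CD cD CL : ℝ}, 0 ≤ CD → 0 < cD → 0 ≤ CL →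
    ∃ A M₁ : ℝ, 0 ≤ A ∧ 0 < M₁ ∧
    ∀ (m K : ℕ) {Mh k R : ℕ} {P' : Fin (d + 1) → ℕ}
      (hN : ∀ μ, N0 ℓ Mh k P' μ = (PV d ℓ m K hd hL).sitesPerDir 0) (D : TDomains d ℓ Mh k P' R) (hk : k ≤ m + K) (_ : 2 ≤ k)
      {a : ℕ} (hMha : Mh = (ℓ + 1) ^ a) (hM8 : 8 ≤ Mh) (_ : 2 * (ℓ + 1) ^ 2 ≤ R) (hP5 : ∀ μ, 5 ≤ P' μ) (_ : 4 ≤ ℓ)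
      (hpl : ∀ c : ↥(cubes D.toDomains), Placed ℓ k P' c.1)
      (_ : M₁ ≤ ((ℓ : ℝ) + 1) * Mh) (_ : N₀ + 1 ≤ R * ((ℓ + 1) * Mh))
      (_ : Real.exp (-(α * σ)) * ((ℓ : ℝ) + 1) ^ ((2 * (d + 1 : ℕ) : ℝ) / N₀) < 1)
      {cf : ℝ} (hcf : cf ≠ 0) {w : BondIdx (domT hN D hk) → ℝ} (hw : ∀ i, 0 < w i) (_ : GlobalBand b₀ b₁ cf w)
      (_ : ∀ c : ↥(cubes D.toDomains), HasMajorant (g := geomTB D) (blkV1 hN D)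
        (mulOp (hB hN D c) *
          (onFun (dE (P := PV d ℓ m K hd hL) cf ∘ₗ (LinearMap.id - RE (domT hN D hk) cf) ∘ₗ dsE cf) -
            Pl hN hk (one_le_of_eight_le hM8) (four_le_of_five_le hP5) hMha c (band_le (d := d) (ℓ := ℓ) hb₀ hb₁) (hpl c) w cf) *
          mulOp (zB hN D (one_le_of_eight_le hM8) (four_le_of_five_le hP5) c))
        (fun y y'' => CD * cf ^ 2 * Real.exp (-(cD * (geomTB D).M)) / (geomTB D).len y ^ 2 * Real.exp (-((2 * σ) * (geomTB D).dist y y''))))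
      (D' : Module.End ℝ (PBond (PV d ℓ m K hd hL) 0 → ℝ)) (Pw : (geomT D).Site → ℝ) (_ : ∀ y, 0 ≤ Pw y)
      (_ : ∀ c : ↥(cubes D.toDomains), HasMajorant (g := geomT D) (blkV1 hN D)
        (mulOp (hB hN D c) * Gl hN hk (one_le_of_eight_le hM8) (four_le_of_five_le hP5) hMha c (band_le (d := d) (ℓ := ℓ) hb₀ hb₁) (hpl c) w cf *
          mulOp (hB hN D c) * D')
        (fun y y' => ind (ST D (one_le_of_eight_le hM8) (four_le_of_five_le hP5) c) y * (CL * Real.exp (-((2 * σ) * (geomT D).dist y y')) * Pw y'))),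
      HasMajorant (g := geomT D) (blkV1 hN D) (onFun (GE (domT hN D hk) hcf hw) * D')
        (fun y y' => A * Real.exp (-((1 - α) * σ * (geomT D).dist y y')) * Pw y') := by
  obtain ⟨σ₀, hσ₀, h⟩ := prop26_2136T_kLevel_assembly_le d ℓ hd hL hb₀ hb₁
  refine ⟨σ₀, hσ₀, fun σ hσ0 hσle α hα0 hα1 N₀ hN₀ CD cD CL hCD hcD hCL => ?_⟩
  have hs₁ : 0 ≤ C1F d ℓ * ((ℓ : ℝ) + 1) ^ 3 := by have := C1F_nonneg d ℓ; positivity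
  have hs₂ : 0 ≤ ((d : ℝ) + 1) * C2F d ℓ * ((ℓ : ℝ) + 1) := by have := C2F_nonneg d ℓ; positivity
  obtain ⟨A, M₁, hA, hM₁, h2⟩ := h σ hσ0 hσle α hα0 hα1 N₀ hN₀ (3 * 9 ^ (d + 1)) hs₁ hs₂ hCD hcD hCL
  refine ⟨A, M₁, hA, hM₁, ?_⟩
  intro m K Mh k R P' hN D hk hk2 a hMha hM8 hR2 hP5 hℓ hpl hLM hRM hθ cf hcf w hw hwb hD3 D' Pw hPw hleg
  exact h2 m K hN D hk hk2 hMha hM8 hR2 hP5 hℓ hpl hLM hRM hθ hcf hw hwb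
    (card_filter_mem_QbigT_le D hL (le_trans (by norm_num) hM8) hR2 (one_le_of_eight_le hM8) (four_le_of_five_le hP5))
    (fun c e x => abs_cfC_le hN hk _ _ hMha c _ hM8 hR2 hP5 (hpl c) w cf e x)
    (fun c e x hx => cfC_supp hN hk _ _ hMha c _ hM8 hR2 hP5 (hpl c) w cf e x hx)
    (fun c x => abs_c0C_le hN hk _ _ hMha c _ hM8 hR2 hP5 (hpl c) w cf x)
    (fun c x hx => c0C_supp hN hk _ _ hMha c _ hM8 hR2 hP5 (hpl c) w cf x hx) hD3 D' Pw hPw hleg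

end Final

end Literature.MathematicalPhysics.QuantumFieldTheory.Balaban1983to89.B6Prop26MirrorAssemblyV1

end
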